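import Summits.BirchSwinnertonDyer.Rank1Residual.X2.GreenbergVatsalTateKummerLocal
import Literature.NumberTheory.EllipticCurves.SpectralValuationUnramified
import Literature.NumberTheory.EllipticCurves.UnramifiedLayerRootsProofs
import HarnessLib

/-!
# Route `ByReductionTypeAtTwo`, crux `MultUpperHalfAtTwo` (item stmt-BirchSwinnertonDyer-19922), TOWER road, Greenberg LNM 1716
# §4 p. 108 «for `v ∣ p`» at a MULTIPLICATIVE place, part 4 — the Tate-side «formal group»: `E₁ = Ψ(units)` and its torsion
# `C = Ψ(μ_{p^∞})` (stability, `p`-divisibility, `E/E₁` torsion, cyclic layers, the flip acts as `−1`)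

HONEST FRAMING (cell `bsd-2adic`, run/shared/lean/pub/bsd-2adic/, seat `bsd-2adic-tower-1` GEN 29, HUMAN RULINGS
D-0036 / D-0054 / D-0074): TOOL theorems only (no definition, no named fact, no `sorry`); closes nothing by itself;
nothing booked; BSD is not proved by any of this.

Setting: `K` a number field, `v` a finite place, `W/K` a Weierstrass curve, Tate's twisted uniformisation at `v`
(`TateCurve.exists_twistedTateUniformisation_tateJ`): `Ψ : K̄_vˣ → E(K̄_v)` onto, kernel `q^ℤ` (`0 < |q|_v < 1`),
`σ•Ψ(u) = χ(σ)Ψ(σu)` with `χ(σ) = 1 ⇔ σt = t`; `w` the spectral valuation of `K̄_v`. The subgroup `E₁ = Ψ({u : |u|_v = 1})`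
plays at a multiplicative place the rôle the formal group `Ê(𝔪̄)` plays at a good place in bsd-inputs-k4-p1's road to
Greenberg's p. 108 local surjectivity (`InputsGreenbergLocalAtP.coinvInput_of_formalH2_of_coatesGreenberg`); its torsion is
`C = E₁[p^∞] = Ψ(μ_{p^∞}) ≅ μ_{p^∞} ⊗ χ`. This file proves the displayed inputs of parts 2–3 (`MultLocSurj.coinvInput_of_H2_…`,
`MultLocSurj.subsingleton_continuousCohomology_two_of_neg`) for this pair, with `E₁`, `C` passed as subgroups described by
membership (`hE₁`, `hC`; no definition is introduced):

* `exists_pow_eq_one_of_mem` / `apply_mem_of_pow_eq_one` — `C = Ψ(μ_{p^∞})`;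
* `smul_mem_of_mem` (`E₁` is `Γ_{K_v}`-stable), `exists_nsmul_eq_of_mem` (`E₁` is `p`-divisible),
  `exists_nsmul_eq_of_mem_torsion` (`C` is `p`-divisible), `exists_generator` (`C[p^r]` is cyclic on `Ψ(ζ_{p^r})`),
  `smul_eq_neg_of_mem` (a `τ` fixing `μ_{p^∞}` with `τt = −t` acts as `−1` on `C`);
* `exists_nsmul_mem` — **`E(K̄_v)/E₁` is torsion**: `|u|_v^d = ‖a₀‖ ∈ |ϖ|^ℤ` for the constant coefficient `a₀` of the minimal
  polynomial of `u` (Neukirch II (4.8), Mathlib `spectralNorm_eq_norm_coeff_zero_rpow`) and `|q|_v = |ϖ|^e`, `e ≥ 1`, so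
  `u^{de} q^{−m}` is a unit and `(de)•Ψ(u) ∈ E₁`.

References: J. Silverman, GTM 151, V.3.1, V.5.2–V.5.3; J. Neukirch, *ANT* II (4.8); R. Greenberg, LNM 1716 §2 pp. 75–76.
-/

set_option autoImplicit false
-- the Theorems namespace of this sub repeats the summit name by design (D-0017 nested layout: Summit.<S>.<Sub>)
set_option linter.dupNamespace false

noncomputable section

open scoped Classical NNReal

universe u

namespace Summit.BirchSwinnertonDyer.BirchSwinnertonDyer.Theorems.MultLocSurj

open NumberField IsDedekindDomain Field Literature.NumberTheory.GaloisRepresentations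
  Literature.NumberTheory.EllipticCurves IsDedekindDomain.HeightOneSpectrum
  Summit.BirchSwinnertonDyer.Rank1Residual.X2

variable {F : Type u} [Field F] [NumberField F] (W : WeierstrassCurve F) {p : ℕ} [hp : Fact p.Prime]
  {v : HeightOneSpectrum (𝓞 F)}
  (Ψ : Additive (AlgebraicClosure (v.adicCompletion F))ˣ →+ localPoints W (v.adicCompletion F))
  {q : v.adicCompletion F}
  (hker : ∀ u : (AlgebraicClosure (v.adicCompletion F))ˣ, Ψ (Additive.ofMul u) = 0 →
    ∃ a : ℤ, (u : AlgebraicClosure (v.adicCompletion F)) =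
      algebraMap (v.adicCompletion F) (AlgebraicClosure (v.adicCompletion F)) q ^ a)
  (hq0 : q ≠ 0) (hq1 : Valued.v q < 1)
  {w : Valuation (AlgebraicClosure (v.adicCompletion F)) ℝ≥0}
  (hw : ∀ x, (w x : ℝ) = spectralNorm (v.adicCompletion F) (AlgebraicClosure (v.adicCompletion F)) x)
  (E₁ C : AddSubgroup (localPoints W (v.adicCompletion F)))
  (hE₁ : ∀ P, P ∈ E₁ ↔ ∃ u : (AlgebraicClosure (v.adicCompletion F))ˣ,
    w (u : AlgebraicClosure (v.adicCompletion F)) = 1 ∧ Ψ (Additive.ofMul u) = P)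
  (hC : ∀ a, a ∈ C ↔ a ∈ E₁ ∧ ∃ e : ℕ, p ^ e • a = 0)

/-! ### The Tate parameter under the spectral valuation -/

include hq0 hq1 hw in
/-- `0 < |q|_v < 1` in `K̄_v`. [cite: SilvermanATAEC1994, Thm. V.5.3 (a)] -/
theorem spectralValuation_tateParameter_pos_lt_one :
    0 < w (algebraMap (v.adicCompletion F) (AlgebraicClosure (v.adicCompletion F)) q) ∧
      w (algebraMap (v.adicCompletion F) (AlgebraicClosure (v.adicCompletion F)) q) < 1 := by
  refine ⟨zero_lt_iff.mpr ((Valuation.ne_zero_iff _).mpr ((map_ne_zero _).mpr hq0)), ?_⟩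
  rw [← NNReal.coe_lt_coe, coe_spectralValuation_algebraMap hw, NNReal.coe_one]
  exact Valued.toNormedField.norm_lt_one_iff.mpr hq1

include hq0 hq1 hw in
/-- `q^n = 1` in `K̄_v` forces `n = 0` (`0 < |q|_v < 1`). [cite: SilvermanATAEC1994, Thm. V.3.1 (c)] -/
theorem eq_zero_of_tateParameter_zpow_eq_one {n : ℤ}
    (h : algebraMap (v.adicCompletion F) (AlgebraicClosure (v.adicCompletion F)) q ^ n = 1) : n = 0 := by
  obtain ⟨h0, h1⟩ := spectralValuation_tateParameter_pos_lt_one (F := F) hq0 hq1 hw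
  have hv' : (w (algebraMap (v.adicCompletion F) (AlgebraicClosure (v.adicCompletion F)) q)) ^ n =
      (w (algebraMap (v.adicCompletion F) (AlgebraicClosure (v.adicCompletion F)) q)) ^ (0 : ℤ) := by
    rw [← map_zpow₀, h, map_one, zpow_zero]
  exact (zpow_right_strictAnti₀ h0 h1).injective hv'

/-! ### `C = Ψ(μ_{p^∞})` -/

omit hp in
include hker hq0 hq1 hw hE₁ hC in
/-- **An element of `C = E₁[p^∞]` is `Ψ(ζ)` with `ζ` a `p`-power root of unity**: `a = Ψ(u)` with `|u| = 1` and `p^e a = 0`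
give `u^{p^e} = q^n`, and `|q^n| = 1` forces `n = 0`. [cite: SilvermanATAEC1994, Thm. V.3.1 (c),(d)] -/
theorem exists_pow_eq_one_of_mem {a : localPoints W (v.adicCompletion F)} (ha : a ∈ C) :
    ∃ ζ : (AlgebraicClosure (v.adicCompletion F))ˣ, (∃ e : ℕ, ζ ^ p ^ e = 1) ∧ Ψ (Additive.ofMul ζ) = a := by
  obtain ⟨ha₁, e, he⟩ := (hC a).mp ha
  obtain ⟨u, hu1, rfl⟩ := (hE₁ _).mp ha₁
  refine ⟨u, ⟨e, ?_⟩, rfl⟩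
  rw [← map_nsmul, ← ofMul_pow] at he
  obtain ⟨n, hn⟩ := hker _ he
  have hwn : w (algebraMap (v.adicCompletion F) (AlgebraicClosure (v.adicCompletion F)) q) ^ n = 1 := by
    rw [← map_zpow₀, ← hn, Units.val_pow_eq_pow_val, map_pow, hu1, one_pow]
  obtain ⟨h0, h1⟩ := spectralValuation_tateParameter_pos_lt_one (F := F) hq0 hq1 hw
  have hn0 : n = 0 := (zpow_right_strictAnti₀ h0 h1).injective (by rw [hwn, zpow_zero])
  rw [hn0, zpow_zero] at hn
  exact Units.ext (hn.trans Units.val_one.symm)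

include hE₁ hC in
/-- **`Ψ(ζ) ∈ C` for a `p`-power root of unity `ζ`** (`|ζ| = 1`, `p^e Ψ(ζ) = Ψ(ζ^{p^e}) = 0`). [folklore] -/
theorem apply_mem_of_pow_eq_one {ζ : (AlgebraicClosure (v.adicCompletion F))ˣ} {e : ℕ} (hζ : ζ ^ p ^ e = 1) :
    Ψ (Additive.ofMul ζ) ∈ C := by
  refine (hC _).mpr ⟨(hE₁ _).mpr ⟨ζ, ?_, rfl⟩, e, ?_⟩
  · exact val_eq_one_of_pow_eq_one w (pow_ne_zero e hp.out.ne_zero)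
      (by rw [← Units.val_pow_eq_pow_val, hζ, Units.val_one])
  · rw [← map_nsmul, ← ofMul_pow, hζ, ofMul_one, map_zero]

/-! ### Stability and divisibility -/

include hw hE₁ in
/-- **`E₁ = Ψ(units)` is `Γ_{K_v}`-stable**: `σ•Ψ(u) = ±Ψ(σu)` and `|σu| = |u|`. [cite: SilvermanATAEC1994, Lemma V.5.2 (c)] -/
theorem smul_mem_of_mem {t : AlgebraicClosure (v.adicCompletion F)}
    (hequiv : ∀ (σ : absoluteGaloisGroup (v.adicCompletion F)) (u : (AlgebraicClosure (v.adicCompletion F))ˣ),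
      σ • Ψ (Additive.ofMul u) =
        (if Field.absoluteGaloisGroup.toAlgEquiv (v.adicCompletion F) σ t = t then (1 : ℤ) else -1) •
          Ψ (Additive.ofMul (Units.map
            (Field.absoluteGaloisGroup.toAlgEquiv (v.adicCompletion F) σ :
              AlgebraicClosure (v.adicCompletion F) →* AlgebraicClosure (v.adicCompletion F)) u)))
    (σ : absoluteGaloisGroup (v.adicCompletion F)) {P : localPoints W (v.adicCompletion F)} (hP : P ∈ E₁) :
    σ • P ∈ E₁ := by
  obtain ⟨u, hu1, rfl⟩ := (hE₁ P).mp hP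
  have hmem : Ψ (Additive.ofMul (Units.map
      (Field.absoluteGaloisGroup.toAlgEquiv (v.adicCompletion F) σ :
        AlgebraicClosure (v.adicCompletion F) →* AlgebraicClosure (v.adicCompletion F)) u)) ∈ E₁ := by
    refine (hE₁ _).mpr ⟨_, ?_, rfl⟩
    rw [Units.coe_map, MonoidHom.coe_coe]
    change w (σ • (u : AlgebraicClosure (v.adicCompletion F))) = 1
    rw [spectralValuation_smul hw, hu1]
  rw [hequiv σ u]
  split_ifs
  · rw [one_zsmul]; exact hmem
  · rw [neg_one_zsmul]; exact E₁.neg_mem hmem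

include hE₁ in
/-- **`E₁` is `p`-divisible**: `K̄_v` is algebraically closed and a `p`-th root of a unit is a unit. [folklore] -/
theorem exists_nsmul_eq_of_mem {a : localPoints W (v.adicCompletion F)} (ha : a ∈ E₁) : ∃ b ∈ E₁, p • b = a := by
  obtain ⟨u, hu1, rfl⟩ := (hE₁ a).mp ha
  obtain ⟨x, hx⟩ := IsAlgClosed.exists_pow_nat_eq (u : AlgebraicClosure (v.adicCompletion F)) hp.out.pos
  have hx0 : x ≠ 0 := by
    rintro rfl
    rw [zero_pow hp.out.ne_zero] at hx
    exact u.ne_zero hx.symm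
  refine ⟨Ψ (Additive.ofMul (Units.mk0 x hx0)), (hE₁ _).mpr ⟨Units.mk0 x hx0, ?_, rfl⟩, ?_⟩
  · rw [Units.val_mk0]
    have h1 : w x ^ p = 1 := by rw [← map_pow, hx, hu1]
    exact (pow_eq_one_iff_of_nonneg zero_le hp.out.ne_zero).mp h1
  · rw [← map_nsmul, ← ofMul_pow]
    congr 2
    exact Units.ext (by rw [Units.val_pow_eq_pow_val, Units.val_mk0, hx])

include hker hq0 hq1 hw hE₁ hC in
/-- **`C` is `p`-divisible**: a `p`-th root of a `p`-power root of unity is a `p`-power root of unity. [folklore] -/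
theorem exists_nsmul_eq_of_mem_torsion {a : localPoints W (v.adicCompletion F)} (ha : a ∈ C) :
    ∃ b ∈ C, p • b = a := by
  obtain ⟨ζ, ⟨e, he⟩, rfl⟩ := exists_pow_eq_one_of_mem W Ψ hker hq0 hq1 hw E₁ C hE₁ hC ha
  obtain ⟨x, hx⟩ := IsAlgClosed.exists_pow_nat_eq (ζ : AlgebraicClosure (v.adicCompletion F)) hp.out.pos
  have hx0 : x ≠ 0 := by
    rintro rfl
    rw [zero_pow hp.out.ne_zero] at hx
    exact ζ.ne_zero hx.symm
  have hxp : Units.mk0 x hx0 ^ p = ζ := Units.ext (by rw [Units.val_pow_eq_pow_val, Units.val_mk0, hx])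
  refine ⟨Ψ (Additive.ofMul (Units.mk0 x hx0)),
    apply_mem_of_pow_eq_one W Ψ E₁ C hE₁ hC (e := e + 1) ?_, ?_⟩
  · rw [pow_succ', pow_mul, hxp, he]
  · rw [← map_nsmul, ← ofMul_pow, hxp]

/-! ### Cyclic layers and the flip -/

include hker hq0 hq1 hw hE₁ hC in
/-- **`C[p^r]` is cyclic on `Ψ(ζ_{p^r})`, an element of order `p^r`** (`Ψ` is injective on roots of unity; a `p^r`-torsion
element of `C` is `Ψ(ξ)` with `ξ^{p^r} = 1`, hence `ξ = ζ^c`). [cite: SilvermanATAEC1994, Thm. V.3.1 (c),(d)] -/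
theorem exists_generator (r : ℕ) : ∃ P₁ ∈ C, addOrderOf P₁ = p ^ r ∧
    ∀ P ∈ C, p ^ r • P = 0 → ∃ c : ℕ, P = c • P₁ := by
  haveI : CharZero (v.adicCompletion F) :=
    charZero_of_injective_algebraMap (algebraMap F (v.adicCompletion F)).injective
  haveI : NeZero ((p ^ r : ℕ) : AlgebraicClosure (v.adicCompletion F)) :=
    ⟨by rw [Nat.cast_pow]; exact pow_ne_zero _ (Nat.cast_ne_zero.mpr hp.out.ne_zero)⟩
  haveI : NeZero (p ^ r) := ⟨pow_ne_zero r hp.out.ne_zero⟩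
  obtain ⟨ζ, hζ⟩ := HasEnoughRootsOfUnity.exists_primitiveRoot (AlgebraicClosure (v.adicCompletion F)) (p ^ r)
  have hζ0 : ζ ≠ 0 := hζ.ne_zero (NeZero.ne _)
  set ζu : (AlgebraicClosure (v.adicCompletion F))ˣ := Units.mk0 ζ hζ0 with hζu
  have hζur : ζu ^ p ^ r = 1 := Units.ext (by rw [Units.val_pow_eq_pow_val, hζu, Units.val_mk0, hζ.pow_eq_one, Units.val_one])
  set P₁ := Ψ (Additive.ofMul ζu) with hP₁
  have hP₁C : P₁ ∈ C := apply_mem_of_pow_eq_one W Ψ E₁ C hE₁ hC hζur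
  -- `m • P₁ = 0 ↔ p^r ∣ m`
  have hP₁tor : ∀ m : ℕ, m • P₁ = 0 → p ^ r ∣ m := by
    intro m hm
    rw [hP₁, ← map_nsmul, ← ofMul_pow] at hm
    have h1 := GreenbergVatsalTateKummerLocal.eq_one_of_isOfFinOrder_of_map_eq_zero W Ψ hker hq0 hq1
      ((isOfFinOrder_iff_pow_eq_one.mpr ⟨p ^ r, pow_pos hp.out.pos r, hζur⟩).pow) hm
    have h2 : ζ ^ m = 1 := by
      have := congrArg (fun x : (AlgebraicClosure (v.adicCompletion F))ˣ ↦ (x : AlgebraicClosure (v.adicCompletion F))) h1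
      simpa only [Units.val_pow_eq_pow_val, hζu, Units.val_mk0, Units.val_one] using this
    exact hζ.dvd_of_pow_eq_one m h2
  have hord : addOrderOf P₁ = p ^ r := by
    have hdvd : addOrderOf P₁ ∣ p ^ r :=
      addOrderOf_dvd_of_nsmul_eq_zero (by rw [hP₁, ← map_nsmul, ← ofMul_pow, hζur, ofMul_one, map_zero])
    obtain ⟨i, hi, heq⟩ := (Nat.dvd_prime_pow hp.out).mp hdvd
    have h2 : p ^ r ∣ p ^ i := by
      rw [← heq]
      exact hP₁tor _ (addOrderOf_nsmul_eq_zero P₁)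
    have hir : r ≤ i := (Nat.pow_dvd_pow_iff_le_right hp.out.one_lt).mp h2
    rw [heq, le_antisymm hi hir]
  refine ⟨P₁, hP₁C, hord, fun P hP hPr ↦ ?_⟩
  obtain ⟨ξ, ⟨e, he⟩, rfl⟩ := exists_pow_eq_one_of_mem W Ψ hker hq0 hq1 hw E₁ C hE₁ hC hP
  -- `ξ^{p^r} = 1`
  rw [← map_nsmul, ← ofMul_pow] at hPr
  have hξr := GreenbergVatsalTateKummerLocal.eq_one_of_isOfFinOrder_of_map_eq_zero W Ψ hker hq0 hq1
    ((isOfFinOrder_iff_pow_eq_one.mpr ⟨p ^ e, pow_pos hp.out.pos e, he⟩).pow) hPr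
  have hξr' : (ξ : AlgebraicClosure (v.adicCompletion F)) ^ p ^ r = 1 := by
    rw [← Units.val_pow_eq_pow_val, hξr, Units.val_one]
  obtain ⟨c, -, hc⟩ := hζ.eq_pow_of_pow_eq_one hξr'
  refine ⟨c, ?_⟩
  rw [hP₁, ← map_nsmul, ← ofMul_pow]
  congr 2
  exact Units.ext (by rw [Units.val_pow_eq_pow_val, hζu, Units.val_mk0, hc])

omit hp in
include hker hq0 hq1 hw hE₁ hC in
/-- **A flip acts as `−1` on `C`**: if `τ` fixes every `p`-power root of unity and `τt = −t` (`t ≠ 0`), then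
`τ•Ψ(ζ) = χ(τ)Ψ(τζ) = −Ψ(ζ)` for every `p`-power root of unity `ζ`. [cite: SilvermanATAEC1994, Lemma V.5.2 (c)] -/
theorem smul_eq_neg_of_mem {t : AlgebraicClosure (v.adicCompletion F)} (ht0 : t ≠ 0)
    (hequiv : ∀ (σ : absoluteGaloisGroup (v.adicCompletion F)) (u : (AlgebraicClosure (v.adicCompletion F))ˣ),
      σ • Ψ (Additive.ofMul u) =
        (if Field.absoluteGaloisGroup.toAlgEquiv (v.adicCompletion F) σ t = t then (1 : ℤ) else -1) •
          Ψ (Additive.ofMul (Units.map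
            (Field.absoluteGaloisGroup.toAlgEquiv (v.adicCompletion F) σ :
              AlgebraicClosure (v.adicCompletion F) →* AlgebraicClosure (v.adicCompletion F)) u)))
    {τ : absoluteGaloisGroup (v.adicCompletion F)}
    (hτfix : ∀ (r : ℕ) (ξ : AlgebraicClosure (v.adicCompletion F)), ξ ^ p ^ r = 1 → τ • ξ = ξ)
    (hτt : τ • t = -t) {P : localPoints W (v.adicCompletion F)} (hP : P ∈ C) : τ • P = -P := by
  haveI : CharZero (AlgebraicClosure (v.adicCompletion F)) :=
    charZero_of_injective_algebraMap (algebraMap F (AlgebraicClosure (v.adicCompletion F))).injective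
  obtain ⟨ζ, ⟨e, he⟩, rfl⟩ := exists_pow_eq_one_of_mem W Ψ hker hq0 hq1 hw E₁ C hE₁ hC hP
  have hne : ¬ Field.absoluteGaloisGroup.toAlgEquiv (v.adicCompletion F) τ t = t := by
    change ¬ τ • t = t
    rw [hτt]
    intro h
    exact ht0 (CharZero.neg_eq_self_iff.mp h)
  have hτζ : Units.map (Field.absoluteGaloisGroup.toAlgEquiv (v.adicCompletion F) τ :
      AlgebraicClosure (v.adicCompletion F) →* AlgebraicClosure (v.adicCompletion F)) ζ = ζ := by
    refine Units.ext ?_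
    rw [Units.coe_map, MonoidHom.coe_coe]
    exact hτfix e ζ (by rw [← Units.val_pow_eq_pow_val, he, Units.val_one])
  rw [hequiv τ ζ, if_neg hne, hτζ, neg_one_zsmul]

/-! ### `E(K̄_v)/E₁` is torsion -/

include hw in
/-- The spectral valuation of a nonzero element of `K_v` is an integral power of that of a uniformiser. [folklore] -/
theorem exists_spectralValuation_algebraMap_eq_zpow {ϖ : v.adicCompletionIntegers F} (hϖ : Irreducible ϖ)
    {a : v.adicCompletion F} (ha : a ≠ 0) :
    ∃ m : ℤ, w (algebraMap (v.adicCompletion F) (AlgebraicClosure (v.adicCompletion F)) a) =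
      w (algebraMap (v.adicCompletion F) (AlgebraicClosure (v.adicCompletion F)) (ϖ : v.adicCompletion F)) ^ m := by
  set f := algebraMap (v.adicCompletion F) (AlgebraicClosure (v.adicCompletion F)) with hf
  have ha0 : 0 < w (f a) := zero_lt_iff.mpr ((Valuation.ne_zero_iff _).mpr ((map_ne_zero _).mpr ha))
  rcases lt_trichotomy (w (f a)) 1 with h | h | h
  · obtain ⟨m, -, hm⟩ := exists_spectralValuation_algebraMap_eq_pow hw hϖ ha0 h
    exact ⟨m, by rw [hm, zpow_natCast]⟩
  · exact ⟨0, by rw [h, zpow_zero]⟩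
  · have hi0 : 0 < w (f a⁻¹) := by
      rw [map_inv₀, map_inv₀]; exact inv_pos.mpr ha0
    have hi1 : w (f a⁻¹) < 1 := by
      rw [map_inv₀, map_inv₀]; exact inv_lt_one_of_one_lt₀ h
    obtain ⟨m, -, hm⟩ := exists_spectralValuation_algebraMap_eq_pow hw hϖ hi0 hi1
    refine ⟨-(m : ℤ), ?_⟩
    rw [map_inv₀, map_inv₀] at hm
    rw [zpow_neg, zpow_natCast, ← hm, inv_inv]

include hq0 hq1 hw hE₁ in
/-- **`E(K̄_v)/E₁` is torsion**: every `P = Ψ(u)` has a positive multiple in `E₁ = Ψ(units)`. With `d` the degree and `a₀`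
the constant coefficient of the minimal polynomial of `u` over `K_v`, `|u|_v^d = ‖a₀‖ = |ϖ|^{m₀}` (Neukirch II (4.8)) and
`|q|_v = |ϖ|^e` with `e ≥ 1`; hence `u^{de} q^{−m₀}` is a unit and `(de)•P = Ψ(u^{de} q^{−m₀}) ∈ E₁`.
[cite: NeukirchANT1999, Ch. II Thm. (4.8)] [cite: SilvermanATAEC1994, Thm. V.3.1 (d)] -/
theorem exists_nsmul_mem (hsurj : Function.Surjective Ψ)
    (hΨq : ∀ u : (AlgebraicClosure (v.adicCompletion F))ˣ,
      (u : AlgebraicClosure (v.adicCompletion F)) =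
        algebraMap (v.adicCompletion F) (AlgebraicClosure (v.adicCompletion F)) q → Ψ (Additive.ofMul u) = 0)
    (P : localPoints W (v.adicCompletion F)) : ∃ n : ℕ, 0 < n ∧ n • P ∈ E₁ := by
  haveI : CharZero (v.adicCompletion F) :=
    charZero_of_injective_algebraMap (algebraMap F (v.adicCompletion F)).injective
  obtain ⟨x, rfl⟩ := hsurj P
  set u : (AlgebraicClosure (v.adicCompletion F))ˣ := Additive.toMul x with hu
  have hx : x = Additive.ofMul u := by rw [hu, ofMul_toMul]
  rw [hx]
  set f := algebraMap (v.adicCompletion F) (AlgebraicClosure (v.adicCompletion F)) with hf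
  -- `|u|^d = ‖a₀‖`
  have hint : IsIntegral (v.adicCompletion F) (u : AlgebraicClosure (v.adicCompletion F)) :=
    Algebra.IsIntegral.isIntegral _
  set d := (minpoly (v.adicCompletion F) (u : AlgebraicClosure (v.adicCompletion F))).natDegree with hd
  have hdpos : 0 < d := minpoly.natDegree_pos hint
  set a₀ := (minpoly (v.adicCompletion F) (u : AlgebraicClosure (v.adicCompletion F))).coeff 0 with ha₀
  have ha₀0 : a₀ ≠ 0 := minpoly.coeff_zero_ne_zero hint u.ne_zero
  have hwud : w (u : AlgebraicClosure (v.adicCompletion F)) ^ d = w (f a₀) := by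
    apply NNReal.coe_injective
    letI := Valued.toNontriviallyNormedField (v.adicCompletion F) (WithZero (Multiplicative ℤ))
    have hwx : (w (u : AlgebraicClosure (v.adicCompletion F)) : ℝ) = ‖a₀‖ ^ (1 / (d : ℝ)) := by
      rw [hw]
      exact spectralNorm.spectralNorm_eq_norm_coeff_zero_rpow (v.adicCompletion F)
        (AlgebraicClosure (v.adicCompletion F)) (u : AlgebraicClosure (v.adicCompletion F))
    rw [NNReal.coe_pow, hwx, ← Real.rpow_natCast, ← Real.rpow_mul (norm_nonneg _),
      one_div_mul_cancel (Nat.cast_ne_zero.mpr hdpos.ne'), Real.rpow_one, hf, coe_spectralValuation_algebraMap hw]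
  -- a uniformiser `ϖ`; `‖a₀‖ = |ϖ|^{m₀}`, `|q| = |ϖ|^e` with `e ≥ 1`
  obtain ⟨ϖ, hϖ⟩ := IsDiscreteValuationRing.exists_irreducible (v.adicCompletionIntegers F)
  obtain ⟨hϖ0, -⟩ := spectralValuation_uniformizer_pos_lt_one hw hϖ
  obtain ⟨m₀, hm₀⟩ := exists_spectralValuation_algebraMap_eq_zpow (F := F) hw hϖ ha₀0
  obtain ⟨hQ0, hQ1⟩ := spectralValuation_tateParameter_pos_lt_one (F := F) hq0 hq1 hw
  obtain ⟨e, he1, he⟩ := exists_spectralValuation_algebraMap_eq_pow hw hϖ hQ0 hQ1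
  -- the unit `u^{de} q^{-m₀}`
  have hfq0 : f q ≠ 0 := (map_ne_zero _).mpr hq0
  set Q : (AlgebraicClosure (v.adicCompletion F))ˣ := Units.mk0 (f q) hfq0 with hQ
  have hΨQ : Ψ (Additive.ofMul Q) = 0 := hΨq Q (by rw [hQ, Units.val_mk0])
  refine ⟨d * e, Nat.mul_pos hdpos he1, (hE₁ _).mpr ⟨u ^ (d * e) * Q ^ (-m₀), ?_, ?_⟩⟩
  · rw [Units.val_mul, Units.val_pow_eq_pow_val, Units.val_zpow_eq_zpow_val, hQ, Units.val_mk0, map_mul, map_pow,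
      map_zpow₀, pow_mul, hwud, hm₀, he, ← zpow_natCast, ← zpow_mul, ← zpow_natCast, ← zpow_mul, mul_neg,
      zpow_neg, mul_comm (e : ℤ) m₀, mul_inv_cancel₀]
    exact zpow_ne_zero _ hϖ0.ne'
  · rw [ofMul_mul, map_add, ofMul_zpow, map_zsmul, hΨQ, smul_zero, add_zero, ofMul_pow, map_nsmul]

end Summit.BirchSwinnertonDyer.BirchSwinnertonDyer.Theorems.MultLocSurj

end
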